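import Literature.AlgebraicGeometry.ProjectiveSpace.PointsHilbertPolynomial
import Literature.AlgebraicGeometry.HodgeTheory.CompleteIntersectionBezout
import Literature.AlgebraicGeometry.HodgeTheory.CompleteIntersectionHilbertFunction
import Literature.RingTheory.GradedAlgebra.GorensteinDoubleAnnihilator
import Literature.Algebra.Homology.LaurentCechSubquotientHyperplaneSection
import HarnessLib

/-!
# The Cayley–Bacharach theorem for hypersurfaces meeting in `∏ dᵢ` points (EGH Thm. CB5 / CB6) and
# Max Noether's `AF + BG` theorem in the transverse case

Topic `Literature/AlgebraicGeometry/ProjectiveSpace`, namespace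
`Literature.AlgebraicGeometry.ProjectiveSpace`. Lane `lit-hodgefound`, seat `lit-hodgefound-p32`,
row gen25-#3. Theorems only (no definition, no named fact).

## The source, as printed

D. Eisenbud, M. Green, J. Harris, *Cayley–Bacharach theorems and conjectures*, Bull. AMS 33 (1996):
(p. 300) "any curve `X` passing through all the points of the intersection of `X_1` and `X_2` is defined
by a polynomial that is a linear combination (with polynomial coefficients) of the polynomials
defining `X_1` and `X_2`. That is, if `F = 0`, `G = 0`, and `H = 0` are the equations of `X_1`, `X_2`,
and `X` respectively, then there exist polynomials `A` and `B` such that `H = AF + BG`. This assertion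
was used by Cayley in the case where the two curves meet transversely … It was finally given a proof
by Max Noether, first in the special case Cayley used"; **Theorem CB5 (Bacharach).** "Let
`X_1, X_2 ⊂ ℙ²` be plane curves of degrees `d` and `e` respectively, intersecting in `d · e` points
`Γ = X_1 ∩ X_2 = {p_1, …, p_{de}}`, and suppose that `Γ` is the disjoint union of subsets `Γ'` and `Γ''`.
Set `s = d + e − 3`. If `k ≤ s` is a nonnegative integer, then the dimension of the vector space of
forms of degree `k` vanishing on `Γ'` (modulo those containing all of `Γ`) is equal to the failure of
`Γ''` to impose independent conditions on forms of degree `s − k`"; **Theorem CB6.** "Let `X_1, …, X_n`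
be hypersurfaces in `ℙⁿ` of degrees `d_1, …, d_n` respectively, meeting transversely, and suppose that
the intersection `Γ = X_1 ∩ ⋯ ∩ X_n` is the disjoint union of subsets `Γ'` and `Γ''`. Set
`s = Σ d_i − n − 1`. If `k ≤ s` is a nonnegative integer, then the dimension of the family of curves of
degree `k` containing `Γ'` (modulo those containing all of `Γ`) is equal to the failure of `Γ''` to
impose independent conditions of curves of "complementary" degree `s − k`"; §1.4 (p. 311), the proof:
"let `H ⊂ ℙⁿ` be a general hyperplane (specifically, one not meeting the support of `Γ`), `L` the linear
form defining `H`, and … `A = R/(L) = S/(L, F_1, …, F_n)` … the Hilbert function of `A` … will be the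
first difference function of the Hilbert function of `R` … The crucial result … is that the ring `A`
is itself Gorenstein, with socle in degree `m`. … the ideal `Ī'' ⊂ A` is just the annihilator of `Ī'`
with respect to the pairing `Q`: clearly they annihilate each other, and the sum of their codimensions
(as `K`-vector spaces) in `A` is equal to the dimension `d` of `R`. In particular, the dimension of the
`j`th graded piece of `Ī''` is the codimension of the `(m − j)`th graded piece of `Ī'`. Summing this
equality over `j = 0, 1, …, l` yields the statement".

## Dictionary

`S = k[x_0, …, x_r]` (`k` an infinite field, `r ≥ 1`), `f_1, …, f_r` (a family `f : Fin r → S`) forms of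
positive degrees `d_m` with `[f_1, …, f_r]` a weakly regular sequence on `S`
(`RingTheory.Sequence.IsWeaklyRegular`); "meeting transversely" / "intersecting in `∏ d_m` points":
a family `p : ι → k^{r+1}` of `#ι = ∏ d_m` non-zero, pairwise non-proportional vectors with
`f_m(p_i) = 0`; `I(Z) = projVanishingIdeal Z` (Hartshorne's homogeneous ideal of the point set `Z`,
`ProjectiveSpace/PointsVanishingIdeal`), and the HILBERT FUNCTION `H_Z(t) = dim_k S_t − dim_k I(Z)_t`
(the number of conditions imposed by `Z` on forms of degree `t`), `dim_k I(Z)_t` = the forms of degree `t`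
through `Z`. `Γ' = {p_i}_{i ∈ T}`, `Γ'' = {p_i}_{i ∉ T}` for `T : Finset ι`.

## What is here (all `theorem`s)

* § 1 a form not vanishing at any point of `Z` is a non-zero-divisor modulo `I(Z)`
  (`mem_projVanishingIdeal_of_mul_mem`); over an infinite field a LINEAR such form exists for a finite
  `Z` (`exists_linearForm_forall_eval_ne_zero`, EGH's "general hyperplane not meeting the support of `Γ`").
* § 2 the first-difference bookkeeping "the Hilbert function of `A` will be the first difference function
  of the Hilbert function of `R`": `idealDegree_sup_span_singleton_zero`,
  `sum_range_hilbert_sup_span_eq` (`Σ_{t ≤ n} H_{S/(I+L)}(t) = H_{S/I}(n)` for `L` linear regular mod `I`).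
* § 3 **Max Noether / Lasker in the transverse case** (`projVanishingIdeal_eq_span_of_card_eq_prod`):
  under the hypotheses above `I(Γ) = (f_1, …, f_r)` — every form through the `∏ d_m` points is
  `Σ A_m f_m`. Proof: a linear `L` regular modulo both `(f)` and `I(Γ)` (tree
  `LaurentCech.exists_linearForm_regular_pair`); `(f, L)` is an Artinian complete intersection of
  colength `∏ d_m` (tree Bézout `finrank_quotient_span_eq_prod_of_X_pow_mem`) containing… contained in
  `I(Γ) + (L)` whose colength is `H_Γ(n ≫ 0) = #ι = ∏ d_m`; so `I(Γ) + (L) = (f) + (L)` and a descending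
  induction on the degree strips `L`.
* § 4 **Theorem CB6** (`hilbert_add_hilbert_eq_of_completeIntersection`, additive form, and
  `finrank_idealDegree_sub_eq_card_sub_hilbert`, the printed form): for `T ⊆ ι` and `k + a = s`,
  `s = Σ d_m − r − 1`: **`dim I(Γ')_k − dim I(Γ)_k = #Γ'' − H_{Γ''}(a)`**. Proof as in EGH §1.4:
  `A = S/(f, L)` is Artinian Gorenstein of socle degree `m = s + 1` (tree
  `isArtinianGorenstein_span_of_isWeaklyRegular`, Macaulay), `(I(Γ'') + L)·(I(Γ') + L) ⊆ (f, L)`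
  (`projVanishingIdeal_colon_image`), Macaulay duality `dim (J : 𝔞)_b − dim J_b = dim S_a − dim 𝔞_a`
  (tree `IsArtinianGorenstein.finrank_idealDegree_colon_sub`) gives
  `ΔH_Γ(b) ≤ ΔH_{Γ''}(b) + ΔH_{Γ'}(m − b)`, and summing over `b = 0..m` both sides equal `#ι`
  ("the sum of their codimensions is the dimension of `R`"), so equality holds termwise; summing over
  `b ≤ k` yields CB6. Corollaries: the Chasles–Cayley form (Thm. CB4 for `r` hypersurfaces,
  `idealDegree_projVanishingIdeal_image_compl_singleton_eq`: a hypersurface of degree `s` through all but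
  one of the points contains all), **Theorem CB5** (`r = 2`, `hilbert_add_hilbert_eq_of_planeCurves`) and
  Noether's `AF + BG` for two plane curves (`projVanishingIdeal_eq_span_pair_of_planeCurves`).

## What is NOT here

* Non-reduced complete intersections (Theorem CB7: arbitrary zero-dimensional `Γ` and residual
  subschemes) — the colength-one case is `HodgeTheory/ProjectiveCompleteIntersectionCayleyBacharach`;
  the converse CB9 / Davis–Geramita–Orecchia.

## References

* [EisenbudGreenHarris1996] D. Eisenbud, M. Green, J. Harris, *Cayley–Bacharach theorems and
  conjectures*, Bull. Amer. Math. Soc. 33 (1996), 295–324: p. 300 (Noether's `AF + BG`), Thm. CB5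
  (p. 303), Thm. CB6 (p. 304), Thm. 8 (Lasker, p. 310), §1.4 (p. 311), Thm. CB8.
* [Eisenbud2005] D. Eisenbud, *The Geometry of Syzygies*, GTM 229, Springer 2005, §4B (PDF p. 99)
  ("imposes independent conditions").
* [Hartshorne1977] R. Hartshorne, *Algebraic Geometry*, GTM 52 (1977), I §2 (p. 10).
-/

noncomputable section

open MvPolynomial Module RingTheory.Sequence
open Literature.RingTheory.MvPolynomial Literature.AlgebraicGeometry.DuqueFrancoVillaflor2025
  Literature.AlgebraicGeometry.HodgeTheory

universe u

namespace Literature.AlgebraicGeometry.ProjectiveSpace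

variable {k : Type u} [Field k] {σ : Type*}

/-! ### § 1 Forms missing the points are non-zero-divisors modulo `I(Z)` -/

/-- **A form `ℓ` with `ℓ(p) ≠ 0` for all `p ∈ Z` is a non-zero-divisor modulo `I(Z)`**: `ℓ g ∈ I(Z)`
forces `g ∈ I(Z)` (degree by degree `(ℓ g)_{n+c}(p) = ℓ(p) g_n(p)`). This is EGH's choice of "a
general hyperplane (specifically, one not meeting the support of `Γ`)", for which "`L` is a
nonzerodivisor in `R`". [cite: EisenbudGreenHarris1996, §1.4 (p. 311)] -/
theorem mem_projVanishingIdeal_of_mul_mem {Z : Set (σ → k)} {ℓ g : MvPolynomial σ k} {c : ℕ}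
    (hℓ : ℓ.IsHomogeneous c) (hne : ∀ p ∈ Z, eval p ℓ ≠ 0) (h : ℓ * g ∈ projVanishingIdeal Z) :
    g ∈ projVanishingIdeal Z := by
  rw [mem_projVanishingIdeal_iff]
  intro n p hp
  have h1 := mem_projVanishingIdeal_iff.mp h (n + c) p hp
  rw [homogeneousComponent_mul_add_of_isHomogeneous hℓ g n, map_mul, mul_eq_zero] at h1
  exact h1.resolve_left (hne p hp)

/-- **A linear form missing finitely many points** (`k` infinite): for a finite family of non-zero
vectors `p_i` there is a linear form `ℓ` with `ℓ(p_i) ≠ 0` for all `i` — the linear forms vanishing at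
`p_i` form a proper subspace of `S_1` (`x_s(p_i) = (p_i)_s ≠ 0` for some `s`), and a vector space over an
infinite field is not a finite union of proper subspaces. ("let `H ⊂ ℙⁿ` be a general hyperplane
(specifically, one not meeting the support of `Γ`)".) [cite: EisenbudGreenHarris1996, §1.4 (p. 311)] -/
theorem exists_linearForm_forall_eval_ne_zero [Infinite k] {ι : Type*} [Finite ι] (p : ι → σ → k)
    (h0 : ∀ i, p i ≠ 0) : ∃ ℓ : MvPolynomial σ k, ℓ.IsHomogeneous 1 ∧ ∀ i, eval (p i) ℓ ≠ 0 := by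
  classical
  haveI : Fintype ι := Fintype.ofFinite ι
  -- `W_i ⊆ S_1`: the linear forms vanishing at `p_i`
  let ev : ι → (homogeneousSubmodule σ k 1 →ₗ[k] k) := fun i =>
    (MvPolynomial.aeval (p i)).toLinearMap ∘ₗ (homogeneousSubmodule σ k 1).subtype
  let W : ι → Submodule k (homogeneousSubmodule σ k 1) := fun i => LinearMap.ker (ev i)
  have hW : ∀ i, ¬ (⊤ : Submodule k (homogeneousSubmodule σ k 1)) ≤ W i := by
    intro i hle
    obtain ⟨s, hs⟩ := Function.ne_iff.mp (h0 i)
    have hX : (⟨X s, isHomogeneous_X k s⟩ : homogeneousSubmodule σ k 1) ∈ W i := hle Submodule.mem_top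
    rw [LinearMap.mem_ker] at hX
    exact hs (by simpa [ev] using hX)
  obtain ⟨v, -, hv⟩ := exists_mem_forall_notMem_of_forall_not_le (⊤ : Submodule k _)
    (Finset.univ.image W) fun W' hW' => by
      obtain ⟨i, -, rfl⟩ := Finset.mem_image.mp hW'
      exact hW i
  refine ⟨v, v.2, fun i => ?_⟩
  have hi := hv (W i) (Finset.mem_image_of_mem W (Finset.mem_univ i))
  rw [LinearMap.mem_ker] at hi
  simpa [ev] using hi

/-! ### § 2 First differences: the Hilbert function of `S/(I + L)` -/

section Differences

variable [Finite σ]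

omit [Finite σ] in
/-- `(I + (L))_0 = I_0` for a homogeneous ideal `I` and a linear form `L` (a multiple of `L` has no
constant term). [cite: EisenbudGreenHarris1996, §1.4 (p. 311)] -/
theorem idealDegree_sup_span_singleton_zero {I : Ideal (MvPolynomial σ k)}
    (hI : ∀ f ∈ I, ∀ d : ℕ, homogeneousComponent d f ∈ I) {L : MvPolynomial σ k}
    (hL : L.IsHomogeneous 1) : idealDegree (I ⊔ Ideal.span {L}) 0 = idealDegree I 0 := by
  refine le_antisymm ?_ (idealDegree_mono le_sup_left 0)
  rintro f ⟨hf, hf0⟩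
  refine ⟨?_, hf0⟩
  obtain ⟨y, hy, z, hz, rfl⟩ := Submodule.mem_sup.mp hf
  obtain ⟨a, rfl⟩ := Ideal.mem_span_singleton'.mp hz
  have hyz : y + a * L = homogeneousComponent 0 y + homogeneousComponent 0 (a * L) := by
    conv_lhs => rw [← homogeneousComponent_eq_self hf0]
    rw [map_add]
  have haL : homogeneousComponent 0 (a * L) = 0 := by
    rw [homogeneousComponent_zero, ← constantCoeff_eq, map_mul, constantCoeff_eq,
      hL.coeff_eq_zero (d := 0) (by simp), mul_zero, C_0]
  rw [hyz, haL, add_zero]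
  exact hI y hy 0

/-- **"The Hilbert function of `A = R/(L)` is the first difference function of the Hilbert function of
`R`"**, summed: for a homogeneous ideal `I` and a linear form `L ≠ 0` that is a non-zero-divisor modulo
`I`, `Σ_{t=0}^{n} H_{S/(I+L)}(t) = H_{S/I}(n)` (`H_{S/J}(t) = dim S_t − dim J_t`).
[cite: EisenbudGreenHarris1996, §1.4 (p. 311)] -/
theorem sum_range_hilbert_sup_span_eq {I : Ideal (MvPolynomial σ k)}
    (hI : ∀ f ∈ I, ∀ d : ℕ, homogeneousComponent d f ∈ I) {L : MvPolynomial σ k} (hL0 : L ≠ 0)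
    (hL : L.IsHomogeneous 1) (hreg : ∀ g, L * g ∈ I → g ∈ I) (n : ℕ) :
    ∑ t ∈ Finset.range (n + 1), (finrank k (homogeneousSubmodule σ k t) -
        finrank k (idealDegree (I ⊔ Ideal.span {L}) t)) =
      finrank k (homogeneousSubmodule σ k n) - finrank k (idealDegree I n) := by
  letI := MvPolynomial.gradedAlgebra (σ := σ) (R := k)
  have hIhom : I.IsHomogeneous (homogeneousSubmodule σ k) := fun d f hf => by
    rw [← DirectSum.Decomposition.decompose'_eq, decomposition.decompose'_apply]
    exact hI f hf d
  induction n with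
  | zero => rw [zero_add, Finset.sum_range_one, idealDegree_sup_span_singleton_zero hI hL]
  | succ n ih =>
    rw [Finset.sum_range_succ, ih]
    have h := hilbert_sup_span_add_hilbert_eq hIhom hL0 hL hreg n
    omega

end Differences

/-! ### § 3 Max Noether's `AF + BG` theorem / Lasker for hypersurfaces meeting in `∏ dᵢ` points -/

section CompleteIntersection

variable {r : ℕ} {ι : Type*} [Fintype ι]

omit [Field k] [Fintype ι] in
/-- `(f_1, …, f_n) = Ideal.ofList [f_1, …, f_n]`. [folklore] -/
private theorem span_range_eq_ofList {R : Type*} [CommSemiring R] {n : ℕ} (f : Fin n → R) :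
    Ideal.span (Set.range f) = Ideal.ofList (List.ofFn f) := by
  change Ideal.span (Set.range f) = Ideal.span {x | x ∈ List.ofFn f}
  congr 1
  ext x
  rw [Set.mem_setOf_eq, List.mem_ofFn']

omit [Fintype ι] in
/-- `(f_1, …, f_r, L) = (f_1, …, f_r) + (L)` for the extended family `Fin.snoc f L`. [folklore] -/
private theorem span_range_snoc (f : Fin r → MvPolynomial (Fin (r + 1)) k) (L : MvPolynomial (Fin (r + 1)) k) :
    Ideal.span (Set.range (Fin.snoc f L : Fin (r + 1) → MvPolynomial (Fin (r + 1)) k)) =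
      Ideal.span (Set.range f) ⊔ Ideal.span {L} := by
  have hlist : List.ofFn (Fin.snoc f L : Fin (r + 1) → MvPolynomial (Fin (r + 1)) k) =
      List.ofFn f ++ [L] := by
    rw [List.ofFn_succ', List.concat_eq_append]
    simp [Fin.snoc_castSucc, Fin.snoc_last]
  rw [span_range_eq_ofList, span_range_eq_ofList, hlist, Ideal.ofList_append, Ideal.ofList_singleton]

omit [Fintype ι] in
/-- The extended sequence `f_1, …, f_r, L` is weakly regular when `L` is a non-zero-divisor modulo
`(f_1, …, f_r)`. [folklore] -/
private theorem isWeaklyRegular_snoc {f : Fin r → MvPolynomial (Fin (r + 1)) k}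
    (hreg : IsWeaklyRegular (MvPolynomial (Fin (r + 1)) k) (List.ofFn f)) {L : MvPolynomial (Fin (r + 1)) k}
    (hL : ∀ g, L * g ∈ Ideal.span (Set.range f) → g ∈ Ideal.span (Set.range f)) :
    IsWeaklyRegular (MvPolynomial (Fin (r + 1)) k)
      (List.ofFn (Fin.snoc f L : Fin (r + 1) → MvPolynomial (Fin (r + 1)) k)) := by
  have hlist : List.ofFn (Fin.snoc f L : Fin (r + 1) → MvPolynomial (Fin (r + 1)) k) =
      List.ofFn f ++ [L] := by
    rw [List.ofFn_succ', List.concat_eq_append]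
    simp [Fin.snoc_castSucc, Fin.snoc_last]
  rw [hlist, isWeaklyRegular_append_iff]
  refine ⟨hreg, (isWeaklyRegular_singleton_iff _ L).mpr ?_⟩
  rw [isSMulRegular_quotient_iff_mem_of_smul_mem]
  intro g hg
  change L * g ∈ Ideal.ofList (List.ofFn f) * ⊤ at hg
  change g ∈ Ideal.ofList (List.ofFn f) * ⊤
  rw [Ideal.mul_top, ← span_range_eq_ofList] at hg ⊢
  exact hL g hg

/-- **The Artinian reduction `A = S/(f_1, …, f_r, L)`**: for forms `f_m` of positive degrees `d_m` with
`[f_1, …, f_r]` weakly regular and a linear form `L` regular modulo `(f)`, the ideal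
`J = (f_1, …, f_r) + (L)` is Artinian Gorenstein of socle degree `m` with `m + r = Σ d_m` (Macaulay /
EGH Thm. CB8), `J_t = S_t` for `t > m`, and `Σ_{t=0}^{m} H_{S/J}(t) = dim_k S/J = ∏ d_m` (Bézout).
[cite: EisenbudGreenHarris1996, §1.4 (p. 311), Thm. CB8] -/
theorem isArtinianGorenstein_span_sup_span_linearForm (f : Fin r → MvPolynomial (Fin (r + 1)) k)
    (d : Fin r → ℕ) (hf : ∀ m, (f m).IsHomogeneous (d m)) (hd : ∀ m, 0 < d m)
    (hreg : IsWeaklyRegular (MvPolynomial (Fin (r + 1)) k) (List.ofFn f))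
    {L : MvPolynomial (Fin (r + 1)) k} (hL1 : L.IsHomogeneous 1)
    (hL : ∀ g, L * g ∈ Ideal.span (Set.range f) → g ∈ Ideal.span (Set.range f))
    {m : ℕ} (hm : m + r = ∑ i, d i) :
    IsArtinianGorenstein (Ideal.span (Set.range f) ⊔ Ideal.span {L}) m ∧
      ∑ t ∈ Finset.range (m + 1), (finrank k (homogeneousSubmodule (Fin (r + 1)) k t) -
        finrank k (idealDegree (Ideal.span (Set.range f) ⊔ Ideal.span {L}) t)) = ∏ i, d i := by
  -- the extended complete intersection `G = (f_1, …, f_r, L)` with degrees `(d_1, …, d_r, 1)`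
  set G : Fin (r + 1) → MvPolynomial (Fin (r + 1)) k := Fin.snoc f L with hGdef
  set d' : Fin (r + 1) → ℕ := Fin.snoc d 1 with hd'def
  have hG : ∀ i, (G i).IsHomogeneous (d' i) := by
    intro i
    refine Fin.lastCases ?_ (fun j => ?_) i
    · simpa [hGdef, hd'def] using hL1
    · simpa [hGdef, hd'def] using hf j
  have hd' : ∀ i, 0 < d' i := by
    intro i
    refine Fin.lastCases ?_ (fun j => ?_) i
    · simp [hd'def]
    · simpa [hd'def] using hd j
  have hsocle : ∑ i, (d' i - 1) = m := by
    rw [Fin.sum_univ_castSucc]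
    simp only [hd'def, Fin.snoc_castSucc, Fin.snoc_last, Nat.sub_self, add_zero]
    have h1 : ∑ i : Fin r, (d i - 1) + r = ∑ i : Fin r, d i := by
      have := Finset.sum_tsub_distrib (s := Finset.univ) (f := d) (g := fun _ => 1)
        (fun i _ => hd i)
      rw [Finset.sum_const, Finset.card_univ, Fintype.card_fin, smul_eq_mul, mul_one] at this
      have hle : r ≤ ∑ i : Fin r, d i := by
        calc r = ∑ _i : Fin r, 1 := by simp
          _ ≤ ∑ i : Fin r, d i := Finset.sum_le_sum fun i _ => hd i
      omega
    omega
  have hprod : ∏ i, d' i = ∏ i, d i := by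
    rw [Fin.prod_univ_castSucc]
    simp [hd'def, Fin.snoc_castSucc, Fin.snoc_last]
  have hspan : Ideal.span (Set.range G) = Ideal.span (Set.range f) ⊔ Ideal.span {L} :=
    span_range_snoc f L
  have hAG : IsArtinianGorenstein (Ideal.span (Set.range G)) m := by
    rw [← hsocle]
    exact isArtinianGorenstein_span_of_isWeaklyRegular G d' hG hd' (isWeaklyRegular_snoc hreg hL)
  refine ⟨hspan ▸ hAG, ?_⟩
  -- Bézout: `dim S/(G) = ∏ d'_i`, and `dim S/(G) = Σ_{t ≤ m} H(t)` since `(G)_t = S_t` for `t > m`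
  have hXN : ∀ i, (X i : MvPolynomial (Fin (r + 1)) k) ^ (m + 1) ∈ Ideal.span (Set.range G) := by
    intro i
    have hmem : (X i : MvPolynomial (Fin (r + 1)) k) ^ (m + 1) ∈ idealDegree (Ideal.span (Set.range G))
        (m + 1) := by
      rw [hAG.idealDegree_eq_of_lt (Nat.lt_succ_self m)]
      exact isHomogeneous_X_pow i (m + 1)
    exact (mem_idealDegree.mp hmem).1
  have hfin := finrank_quotient_span_eq_prod_of_X_pow_mem G d' hG hd' (Nat.succ_pos m) hXN
  rw [finrank_quotient_eq_sum_hilbert hAG.isHomogeneous (T := m) (fun t ht q hq => by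
      have hq' : q ∈ idealDegree (Ideal.span (Set.range G)) t := by
        rw [hAG.idealDegree_eq_of_lt ht]; exact hq
      exact (mem_idealDegree.mp hq').1), hprod] at hfin
  rw [← hspan]
  exact hfin

/-- **Max Noether's `AF + BG` theorem (Cayley's transverse case) / Lasker: the ideal of hypersurfaces
meeting in `∏ dᵢ` points is the ideal of the points.** Let `f_1, …, f_r` be forms of positive degrees
`d_m` in `S = k[x_0, …, x_r]` (`k` infinite, `r ≥ 1`) forming a weakly regular sequence, and let
`Γ = {p_i}_{i ∈ ι}` be `#ι = ∏ d_m` distinct points of `ℙ^r` (non-zero, pairwise non-proportional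
vectors) at which every `f_m` vanishes. Then **`I(Γ) = (f_1, …, f_r)`**: every form vanishing at all the
`p_i` is `Σ A_m f_m` ("there exist polynomials `A` and `B` such that `H = AF + BG`"). Proof (EGH §1.4):
take a linear `L` regular modulo `(f)` and modulo `I(Γ)`; `J = (f, L) ⊆ 𝔞 = I(Γ) + (L)`, `J` has
colength `∏ d_m` spread over degrees `0..m` (Bézout), `𝔞` has `Σ_{t ≤ n} H_{S/𝔞}(t) = H_Γ(n) = #ι` for
`n ≫ 0`; comparing, `H_{S/𝔞} = H_{S/J}` termwise, so `𝔞 = J` degreewise, and `I(Γ)_n ⊆ (f)_n` by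
induction on `n` (strip `L` using its regularity modulo `I(Γ)`).
[cite: EisenbudGreenHarris1996, §1.1 (p. 300), Thm. 8 (Lasker, p. 310), §1.4 (p. 311)] -/
theorem projVanishingIdeal_eq_span_of_card_eq_prod [Infinite k] (hr : 1 ≤ r)
    (f : Fin r → MvPolynomial (Fin (r + 1)) k)
    (d : Fin r → ℕ) (hf : ∀ m, (f m).IsHomogeneous (d m)) (hd : ∀ m, 0 < d m)
    (hreg : IsWeaklyRegular (MvPolynomial (Fin (r + 1)) k) (List.ofFn f))
    (p : ι → Fin (r + 1) → k) (h0 : ∀ i, p i ≠ 0)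
    (hp : Pairwise fun i j => p i ∉ (k ∙ p j : Submodule k (Fin (r + 1) → k)))
    (hZ : ∀ i m, eval (p i) (f m) = 0) (hcard : Fintype.card ι = ∏ m, d m) :
    projVanishingIdeal (Set.range p) = Ideal.span (Set.range f) := by
  classical
  set I := Ideal.span (Set.range f) with hIdef
  set IΓ := projVanishingIdeal (Set.range p) with hIΓdef
  have hIle : I ≤ IΓ := by
    rw [hIdef, Ideal.span_le]
    rintro _ ⟨m, rfl⟩
    exact mem_projVanishingIdeal_of_isHomogeneous (hf m) (by rintro _ ⟨i, rfl⟩; exact hZ i m)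
  have hIhom' : ∀ g ∈ I, ∀ n : ℕ, homogeneousComponent n g ∈ I := by
    letI := MvPolynomial.gradedAlgebra (σ := Fin (r + 1)) (R := k)
    have hIhom : I.IsHomogeneous (homogeneousSubmodule (Fin (r + 1)) k) :=
      Ideal.homogeneous_span _ _ (by rintro _ ⟨m, rfl⟩; exact ⟨d m, hf m⟩)
    exact fun g hg n => homogeneousComponent_mem_of_mem hIhom hg n
  have hIΓhom' : ∀ g ∈ IΓ, ∀ n : ℕ, homogeneousComponent n g ∈ IΓ := fun g hg n =>
    homogeneousComponent_mem_of_mem (isHomogeneous_projVanishingIdeal _) hg n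
  have h0Z : (0 : Fin (r + 1) → k) ∉ Set.range p := by rintro ⟨i, hi⟩; exact h0 i hi
  -- a linear form regular modulo `(f)` and modulo `I(Γ)` (prime avoidance in the Čech dictionary)
  have hhomlist : ∀ g ∈ List.ofFn f, ∃ c : ℕ, g.IsHomogeneous c := by
    intro g hg
    obtain ⟨m, rfl⟩ := (List.mem_ofFn' f g).mp hg
    exact ⟨d m, hf m⟩
  have hregU : IsWeaklyRegular (Unit → MvPolynomial (Fin (r + 1)) k) (List.ofFn f) :=
    ((LinearEquiv.funUnique Unit (MvPolynomial (Fin (r + 1)) k)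
      (MvPolynomial (Fin (r + 1)) k)).isWeaklyRegular_congr (List.ofFn f)).mpr hreg
  have hsat : Literature.Algebra.Homology.LaurentCech.sat
      (Ideal.ofList (List.ofFn f) • (⊤ : Submodule (MvPolynomial (Fin (r + 1)) k)
        (Unit → MvPolynomial (Fin (r + 1)) k))) = Ideal.ofList (List.ofFn f) • ⊤ :=
    Literature.Algebra.Homology.LaurentCech.sat_ofList_smul_top_eq hr (List.ofFn f) hhomlist hregU
      (by rw [List.length_ofFn])
  obtain ⟨L, hL0, hL1, -, hLI, hLΓ⟩ :=
    Literature.Algebra.Homology.LaurentCech.exists_linearForm_regular_pair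
      (Ideal.ofList (List.ofFn f) • (⊤ : Submodule (MvPolynomial (Fin (r + 1)) k)
        (Unit → MvPolynomial (Fin (r + 1)) k)))
      (IΓ • (⊤ : Submodule (MvPolynomial (Fin (r + 1)) k) (Unit → MvPolynomial (Fin (r + 1)) k)))
      (fun v hv => Literature.Algebra.Homology.LaurentCech.mem_of_forall_X_smul_mem_of_sat_le hsat.le v hv)
      (fun v hv => by
        rw [mem_ideal_smul_top_iff]
        refine mem_projVanishingIdeal_of_forall_X_mul_mem h0Z fun s => ?_
        have := hv s
        rwa [mem_ideal_smul_top_iff, Pi.smul_apply, smul_eq_mul] at this)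
  -- regularity of `L` in ideal form
  have hLI' : ∀ g, L * g ∈ I → g ∈ I := by
    intro g hg
    have h1 := hLI (fun _ => g) (by
      rw [mem_ideal_smul_top_iff, Pi.smul_apply, smul_eq_mul, ← span_range_eq_ofList]; exact hg)
    rwa [mem_ideal_smul_top_iff, ← span_range_eq_ofList] at h1
  have hLΓ' : ∀ g, L * g ∈ IΓ → g ∈ IΓ := by
    intro g hg
    have h1 := hLΓ (fun _ => g) (by rw [mem_ideal_smul_top_iff, Pi.smul_apply, smul_eq_mul]; exact hg)
    rwa [mem_ideal_smul_top_iff] at h1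
  -- the Artinian reduction `J = (f) + (L)` and `𝔞 = I(Γ) + (L) ⊇ J`
  obtain ⟨m, hm⟩ : ∃ m : ℕ, m + r = ∑ i, d i := by
    have hle : r ≤ ∑ i : Fin r, d i := by
      calc r = ∑ _i : Fin r, 1 := by simp
        _ ≤ ∑ i : Fin r, d i := Finset.sum_le_sum fun i _ => hd i
    exact ⟨∑ i, d i - r, by omega⟩
  obtain ⟨hAG, hsum⟩ := isArtinianGorenstein_span_sup_span_linearForm f d hf hd hreg hL1 hLI' hm
  set J := I ⊔ Ideal.span {L} with hJdef
  set 𝔞 := IΓ ⊔ Ideal.span {L} with h𝔞def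
  have hJ𝔞 : J ≤ 𝔞 := sup_le_sup_right hIle _
  -- `Σ_{t ≤ n} H_{S/𝔞}(t) = H_Γ(n)`, `H_{S/𝔞}(t) ≤ H_{S/J}(t) = 0` for `t > m`
  have htel := sum_range_hilbert_sup_span_eq hIΓhom' hL0 hL1 hLΓ'
  have hanti : ∀ t, finrank k (homogeneousSubmodule (Fin (r + 1)) k t) - finrank k (idealDegree 𝔞 t) ≤
      finrank k (homogeneousSubmodule (Fin (r + 1)) k t) - finrank k (idealDegree J t) :=
    fun t => hilbert_antitone hJ𝔞 t
  have hzero : ∀ t, m < t →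
      finrank k (homogeneousSubmodule (Fin (r + 1)) k t) - finrank k (idealDegree 𝔞 t) = 0 := by
    intro t ht
    have h := hanti t
    rw [hAG.idealDegree_eq_of_lt ht, Nat.sub_self] at h
    exact Nat.le_zero.mp h
  -- `H_Γ(n) = Σ_{t ≤ m} H_{S/𝔞}(t)` for all `n ≥ m`, hence `= #ι`
  have hstab : ∀ n, m ≤ n → ∑ t ∈ Finset.range (n + 1),
      (finrank k (homogeneousSubmodule (Fin (r + 1)) k t) - finrank k (idealDegree 𝔞 t)) =
      ∑ t ∈ Finset.range (m + 1),
        (finrank k (homogeneousSubmodule (Fin (r + 1)) k t) - finrank k (idealDegree 𝔞 t)) := by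
    intro n hn
    induction n, hn using Nat.le_induction with
    | base => rfl
    | succ n hn ih => rw [Finset.sum_range_succ, ih, hzero (n + 1) (by omega), add_zero]
  have hsum𝔞 : ∑ t ∈ Finset.range (m + 1),
      (finrank k (homogeneousSubmodule (Fin (r + 1)) k t) - finrank k (idealDegree 𝔞 t)) = ∏ i, d i := by
    rw [← hstab (max m (Fintype.card ι)) (le_max_left _ _), htel, ← hcard]
    exact hilbert_projVanishingIdeal_eq_card p h0 hp (by have := le_max_right m (Fintype.card ι); omega)
  -- termwise equality `H_{S/𝔞}(t) = H_{S/J}(t)` for `t ≤ m`, hence `𝔞_t = J_t` for every `t`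
  have hterm := (Finset.sum_eq_sum_iff_of_le fun t _ => hanti t).mp (hsum𝔞.trans hsum.symm)
  have hdeg : ∀ t, idealDegree 𝔞 t = idealDegree J t := by
    intro t
    haveI := finite_homogeneousSubmodule (K := k) (σ := Fin (r + 1)) t
    haveI := Submodule.finiteDimensional_of_le (idealDegree_le_homogeneousSubmodule 𝔞 t)
    by_cases ht : m < t
    · apply le_antisymm _ (idealDegree_mono hJ𝔞 t)
      rw [hAG.idealDegree_eq_of_lt ht]
      exact idealDegree_le_homogeneousSubmodule 𝔞 t
    · have h := hterm t (Finset.mem_range.mpr (by omega))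
      have h1 := finrank_idealDegree_le 𝔞 t
      have h2 := finrank_idealDegree_le J t
      have h3 := finrank_idealDegree_mono hJ𝔞 t
      exact (Submodule.eq_of_le_of_finrank_eq (idealDegree_mono hJ𝔞 t) (by omega)).symm
  -- `I(Γ)_n ⊆ (f)_n` by induction on `n`, stripping `L`
  have hmain : ∀ n, idealDegree IΓ n ≤ idealDegree I n := by
    intro n
    induction n with
    | zero =>
      calc idealDegree IΓ 0 ≤ idealDegree 𝔞 0 := idealDegree_mono le_sup_left 0
        _ = idealDegree J 0 := hdeg 0
        _ = idealDegree I 0 := idealDegree_sup_span_singleton_zero hIhom' hL1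
    | succ n ih =>
      rintro x ⟨hxΓ, hxn⟩
      have hxJ : x ∈ idealDegree J (n + 1) := hdeg (n + 1) ▸ (⟨Ideal.mem_sup_left hxΓ, hxn⟩ : x ∈ idealDegree 𝔞 (n + 1))
      letI := MvPolynomial.gradedAlgebra (σ := Fin (r + 1)) (R := k)
      have hIhom : I.IsHomogeneous (homogeneousSubmodule (Fin (r + 1)) k) :=
        Ideal.homogeneous_span _ _ (by rintro _ ⟨m', rfl⟩; exact ⟨d m', hf m'⟩)
      rw [hJdef, idealDegree_sup_span_singleton hIhom hL1 n] at hxJ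
      obtain ⟨y, hy, _, ⟨z, hz, rfl⟩, hyz⟩ := Submodule.mem_sup.mp hxJ
      have hLz : L * z ∈ IΓ := by
        have : (LinearMap.mulLeft k L) z = x - y := eq_sub_of_add_eq' hyz
        rw [LinearMap.mulLeft_apply] at this
        rw [this]
        exact IΓ.sub_mem hxΓ (hIle hy.1)
      have hzI : z ∈ I := (ih ⟨hLΓ' z hLz, hz⟩).1
      refine ⟨?_, hxn⟩
      rw [← hyz]
      exact I.add_mem hy.1 (I.mul_mem_left L hzI)
  refine le_antisymm (fun g hg => ?_) hIle
  rw [← sum_homogeneousComponent g]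
  exact Ideal.sum_mem _ fun n _ =>
    (hmain n ⟨hIΓhom' g hg n, homogeneousComponent_isHomogeneous n g⟩).1


/-! ### § 4 The Cayley–Bacharach theorem (EGH Thm. CB6 / CB5) -/

omit [Fintype ι] in
/-- Sub-families of an independent family of points are independent: if `Z = {p_i}_{i ∈ ι}` imposes
independent conditions on forms of degree `n` (`H_Z(n) = #ι`), so does `{p_i}_{i ∈ T}` (`H = #T`).
[cite: Eisenbud2005, §4B (PDF p. 99)] -/
theorem hilbert_projVanishingIdeal_image_eq_card [Fintype ι] {σ : Type*} [Finite σ] (P : ι → σ → k)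
    {n : ℕ} (h : finrank k (homogeneousSubmodule σ k n) -
      finrank k (idealDegree (projVanishingIdeal (Set.range P)) n) = Fintype.card ι) (T : Finset ι) :
    finrank k (homogeneousSubmodule σ k n) -
      finrank k (idealDegree (projVanishingIdeal (P '' (T : Set ι))) n) = T.card := by
  have hrange : Set.range (fun t : T => P t) = P '' (T : Set ι) := by
    ext x
    constructor
    · rintro ⟨t, rfl⟩; exact ⟨t, t.2, rfl⟩
    · rintro ⟨i, hi, rfl⟩; exact ⟨⟨i, hi⟩, rfl⟩
  rw [← hrange, ← Fintype.card_coe T]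
  rw [hilbert_projVanishingIdeal_eq_card_iff] at h ⊢
  intro t
  obtain ⟨F, hFn, hFj, hFi⟩ := h t
  exact ⟨F, hFn, fun t' ht' => hFj t' fun heq => ht' (Subtype.ext heq), hFi⟩

omit [Fintype ι] in
/-- The Hilbert function of a sub-family is at most its size. [cite: Eisenbud2005, §4B (PDF p. 99)] -/
theorem hilbert_projVanishingIdeal_image_le_card {σ : Type*} [Finite σ] (P : ι → σ → k) (n : ℕ)
    (T : Finset ι) :
    finrank k (homogeneousSubmodule σ k n) -
      finrank k (idealDegree (projVanishingIdeal (P '' (T : Set ι))) n) ≤ T.card := by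
  have hrange : Set.range (fun t : T => P t) = P '' (T : Set ι) := by
    ext x
    constructor
    · rintro ⟨t, rfl⟩; exact ⟨t, t.2, rfl⟩
    · rintro ⟨i, hi, rfl⟩; exact ⟨⟨i, hi⟩, rfl⟩
  rw [← hrange, ← Fintype.card_coe T]
  exact hilbert_projVanishingIdeal_le_card _ n

omit [Field k] [Fintype ι] in
/-- Telescoping bookkeeping: `Σ_{b ≤ kk} g(m − b) + Σ_{t ≤ a} g(t) = Σ_{t ≤ m} g(t)` for
`kk + a + 1 = m`. [folklore] -/
private theorem sum_range_sub_add_sum_range {g : ℕ → ℕ} {kk a m : ℕ} (h : kk + a + 1 = m) :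
    ∑ b ∈ Finset.range (kk + 1), g (m - b) + ∑ t ∈ Finset.range (a + 1), g t =
      ∑ t ∈ Finset.range (m + 1), g t := by
  have h1 : ∑ b ∈ Finset.range (kk + 1), g (m - b) = ∑ t ∈ Finset.Ico (a + 1) (m + 1), g t := by
    rw [Finset.sum_Ico_eq_sum_range, show m + 1 - (a + 1) = kk + 1 by omega,
      ← Finset.sum_range_reflect (fun b => g (m - b)) (kk + 1)]
    refine Finset.sum_congr rfl fun j hj => ?_
    rw [Finset.mem_range] at hj
    congr 1
    omega
  rw [h1, add_comm, Finset.sum_range_add_sum_Ico _ (by omega)]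

/-- **The Cayley–Bacharach theorem for hypersurfaces meeting in `∏ dᵢ` points (EGH Theorem CB6),
additive form.** Let `f_1, …, f_r` be forms of positive degrees `d_m` in `k[x_0, …, x_r]` (`k`
infinite, `r ≥ 1`) forming a weakly regular sequence and vanishing at `#ι = ∏ d_m` distinct points
`Γ = {p_i}`; split `Γ = Γ' ⊔ Γ''` with `Γ' = {p_i}_{i ∈ T}`, `Γ'' = {p_i}_{i ∉ T}`, and let
`kk + a = s = Σ d_m − r − 1`. Then **`H_Γ(kk) + H_{Γ''}(a) = H_{Γ'}(kk) + #Γ''`**, where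
`H_X(t) = dim_k S_t − dim_k I(X)_t` counts the conditions imposed by `X` on forms of degree `t` — i.e.
`dim I(Γ')_kk − dim I(Γ)_kk` ("the dimension of the family of curves of degree `k` containing `Γ'`
modulo those containing all of `Γ`") equals `#Γ'' − H_{Γ''}(s − k)` ("the failure of `Γ''` to impose
independent conditions of curves of complementary degree `s − k`"). Proof: EGH §1.4 — `A = S/(f, L)`
is Artinian Gorenstein of socle degree `s + 1` for a linear `L` missing `Γ`, `(I(Γ') + L)(I(Γ'') + L)
⊆ (f, L) = I(Γ) + (L)` (Noether), Macaulay duality bounds `ΔH_Γ(b) ≤ ΔH_{Γ'}(b) + ΔH_{Γ''}(s + 1 − b)`,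
both sides sum to `#ι` over `b ≤ s + 1`, and summing the resulting equalities over `b ≤ kk` gives the
statement. [cite: EisenbudGreenHarris1996, Thm. CB6 (p. 304), §1.4 (p. 311)] -/
theorem hilbert_add_hilbert_eq_of_completeIntersection [Infinite k] [DecidableEq ι] (hr : 1 ≤ r)
    (f : Fin r → MvPolynomial (Fin (r + 1)) k) (d : Fin r → ℕ) (hf : ∀ m, (f m).IsHomogeneous (d m))
    (hd : ∀ m, 0 < d m) (hreg : IsWeaklyRegular (MvPolynomial (Fin (r + 1)) k) (List.ofFn f))
    (p : ι → Fin (r + 1) → k) (h0 : ∀ i, p i ≠ 0)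
    (hp : Pairwise fun i j => p i ∉ (k ∙ p j : Submodule k (Fin (r + 1) → k)))
    (hZ : ∀ i m, eval (p i) (f m) = 0) (hcard : Fintype.card ι = ∏ m, d m) (T : Finset ι)
    {kk a : ℕ} (hka : kk + a + r + 1 = ∑ m, d m) :
    (finrank k (homogeneousSubmodule (Fin (r + 1)) k kk) -
        finrank k (idealDegree (projVanishingIdeal (Set.range p)) kk)) +
      (finrank k (homogeneousSubmodule (Fin (r + 1)) k a) -
        finrank k (idealDegree (projVanishingIdeal (p '' ((T : Set ι)ᶜ))) a)) =
      (finrank k (homogeneousSubmodule (Fin (r + 1)) k kk) -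
        finrank k (idealDegree (projVanishingIdeal (p '' (T : Set ι))) kk)) + Tᶜ.card := by
  classical
  letI := MvPolynomial.gradedAlgebra (σ := Fin (r + 1)) (R := k)
  -- notation
  set IΓ := projVanishingIdeal (Set.range p) with hIΓdef
  set I' := projVanishingIdeal (p '' (T : Set ι)) with hI'def
  set I'' := projVanishingIdeal (p '' ((T : Set ι)ᶜ)) with hI''def
  have hNoether : IΓ = Ideal.span (Set.range f) :=
    projVanishingIdeal_eq_span_of_card_eq_prod hr f d hf hd hreg p h0 hp hZ hcard
  have hI'le : IΓ ≤ I' := projVanishingIdeal_anti (Set.image_subset_range _ _)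
  have hI''le : IΓ ≤ I'' := projVanishingIdeal_anti (Set.image_subset_range _ _)
  have hcomp : ∀ g (J : Ideal (MvPolynomial (Fin (r + 1)) k)) (Z : Set (Fin (r + 1) → k)),
      J = projVanishingIdeal Z → g ∈ J → ∀ n : ℕ, homogeneousComponent n g ∈ J := by
    rintro g J Z rfl hg n
    exact homogeneousComponent_mem_of_mem (isHomogeneous_projVanishingIdeal Z) hg n
  -- a linear form missing all the points: regular modulo `I(Γ)`, `I(Γ')`, `I(Γ'')`
  obtain ⟨L, hL1, hLne⟩ := exists_linearForm_forall_eval_ne_zero p h0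
  have hL0 : L ≠ 0 := by
    obtain ⟨i⟩ : Nonempty ι := by
      rw [← Fintype.card_pos_iff, hcard]
      exact Finset.prod_pos fun m _ => hd m
    intro h; exact hLne i (by rw [h, map_zero])
  have hregZ : ∀ (Z : Set (Fin (r + 1) → k)), Z ⊆ Set.range p → ∀ g,
      L * g ∈ projVanishingIdeal Z → g ∈ projVanishingIdeal Z := by
    intro Z hZ g hg
    refine mem_projVanishingIdeal_of_mul_mem hL1 (fun q hq => ?_) hg
    obtain ⟨i, rfl⟩ := hZ hq
    exact hLne i
  have hLΓ := hregZ _ subset_rfl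
  have hLI : ∀ g, L * g ∈ Ideal.span (Set.range f) → g ∈ Ideal.span (Set.range f) := by
    rw [← hNoether]; exact hLΓ
  -- the Artinian Gorenstein reduction `J = (f) + (L) = I(Γ) + (L)`, socle degree `m = kk + a + 1`
  obtain ⟨hAG, hsum⟩ := isArtinianGorenstein_span_sup_span_linearForm f d hf hd hreg hL1 hLI
    (m := kk + a + 1) (by omega)
  set m := kk + a + 1 with hmdef
  set J := Ideal.span (Set.range f) ⊔ Ideal.span {L} with hJdef
  set 𝔞' := I' ⊔ Ideal.span {L} with h𝔞'def
  set 𝔞'' := I'' ⊔ Ideal.span {L} with h𝔞''def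
  have hJ𝔞' : J ≤ 𝔞' := sup_le_sup_right (hNoether ▸ hI'le) _
  have hJ𝔞'' : J ≤ 𝔞'' := sup_le_sup_right (hNoether ▸ hI''le) _
  -- `𝔞' · 𝔞'' ⊆ J`: `I(Γ') I(Γ'') ⊆ I(Γ)` (the residual point set is the colon ideal)
  have hcolon : (IΓ).colon (I' : Set (MvPolynomial (Fin (r + 1)) k)) = I'' := by
    rw [hIΓdef, hI'def, hI''def, projVanishingIdeal_colon_image p hp]
  have hkey : 𝔞' ≤ J.colon (𝔞'' : Set (MvPolynomial (Fin (r + 1)) k)) := by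
    intro x hx
    rw [Submodule.mem_colon]
    intro y hy
    obtain ⟨a₁, ha₁, u, hu, rfl⟩ := Submodule.mem_sup.mp hx
    obtain ⟨b₁, hb₁, v, hv, rfl⟩ := Submodule.mem_sup.mp hy
    have hab : a₁ * b₁ ∈ IΓ := by
      have hb : b₁ ∈ (IΓ).colon (I' : Set (MvPolynomial (Fin (r + 1)) k)) := by rw [hcolon]; exact hb₁
      have := Submodule.mem_colon.mp hb a₁ ha₁
      rwa [smul_eq_mul, mul_comm] at this
    rw [smul_eq_mul, show (a₁ + u) * (b₁ + v) = a₁ * b₁ + (a₁ * v + u * (b₁ + v)) by ring]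
    refine J.add_mem ?_ (Ideal.mem_sup_right (Ideal.add_mem _ (Ideal.mul_mem_left _ _ hv)
      (Ideal.mul_mem_right _ _ hu)))
    rw [hJdef, ← hNoether]
    exact Ideal.mem_sup_left hab
  -- homogeneity of `𝔞''` (for Macaulay duality)
  have h𝔞''hom : 𝔞''.IsHomogeneous (homogeneousSubmodule (Fin (r + 1)) k) :=
    (isHomogeneous_projVanishingIdeal _).sup (Ideal.homogeneous_span _ _ fun x hx =>
      ⟨1, by rw [Set.mem_singleton_iff.mp hx]; exact hL1⟩)
  -- the three Hilbert functions of the Artinian reductions `S/J`, `S/𝔞'`, `S/𝔞''`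
  set hJ : ℕ → ℕ := fun t => finrank k (homogeneousSubmodule (Fin (r + 1)) k t) -
    finrank k (idealDegree J t) with hhJ
  set h' : ℕ → ℕ := fun t => finrank k (homogeneousSubmodule (Fin (r + 1)) k t) -
    finrank k (idealDegree 𝔞' t) with hh'
  set h'' : ℕ → ℕ := fun t => finrank k (homogeneousSubmodule (Fin (r + 1)) k t) -
    finrank k (idealDegree 𝔞'' t) with hh''
  -- Macaulay duality + `𝔞' ≤ (J : 𝔞'')`: `hJ(b) ≤ h'(b) + h''(m - b)` for `b ≤ m`
  have hineq : ∀ b ∈ Finset.range (m + 1), hJ b ≤ h' b + h'' (m - b) := by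
    intro b hb
    rw [Finset.mem_range] at hb
    have hdual := hAG.finrank_idealDegree_colon_sub h𝔞''hom hJ𝔞'' (a := m - b) (b := b) (by omega)
    have h1 := finrank_idealDegree_mono hkey b
    have h2 := finrank_idealDegree_mono hJ𝔞' b
    have h3 := finrank_idealDegree_le 𝔞' b
    have h4 := finrank_idealDegree_le (J.colon (𝔞'' : Set (MvPolynomial (Fin (r + 1)) k))) b
    simp only [hhJ, hh', hh'']
    omega
  -- the sums: `Σ_{t ≤ n} hJ = H_Γ(n)`, `Σ h' = H_{Γ'}`, `Σ h'' = H_{Γ''}` (first differences)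
  have htelJ : ∀ n, ∑ t ∈ Finset.range (n + 1), hJ t =
      finrank k (homogeneousSubmodule (Fin (r + 1)) k n) - finrank k (idealDegree IΓ n) := by
    intro n
    have := sum_range_hilbert_sup_span_eq (hcomp · IΓ _ hIΓdef) hL0 hL1 hLΓ n
    rw [hNoether] at this ⊢
    exact this
  have htel' : ∀ n, ∑ t ∈ Finset.range (n + 1), h' t =
      finrank k (homogeneousSubmodule (Fin (r + 1)) k n) - finrank k (idealDegree I' n) :=
    fun n => sum_range_hilbert_sup_span_eq (hcomp · I' _ hI'def) hL0 hL1
      (hregZ _ (Set.image_subset_range _ _)) n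
  have htel'' : ∀ n, ∑ t ∈ Finset.range (n + 1), h'' t =
      finrank k (homogeneousSubmodule (Fin (r + 1)) k n) - finrank k (idealDegree I'' n) :=
    fun n => sum_range_hilbert_sup_span_eq (hcomp · I'' _ hI''def) hL0 hL1
      (hregZ _ (Set.image_subset_range _ _)) n
  -- in degree `m`: `H_Γ(m) = ∏ d = #ι`, hence `H_{Γ'}(m) = #T`, `H_{Γ''}(m) = #Tᶜ`
  have hΓm : finrank k (homogeneousSubmodule (Fin (r + 1)) k m) - finrank k (idealDegree IΓ m) =
      Fintype.card ι := by
    rw [← htelJ m, hsum, hcard]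
  have hΓ'm : finrank k (homogeneousSubmodule (Fin (r + 1)) k m) - finrank k (idealDegree I' m) =
      T.card := hilbert_projVanishingIdeal_image_eq_card p hΓm T
  have hΓ''m : finrank k (homogeneousSubmodule (Fin (r + 1)) k m) - finrank k (idealDegree I'' m) =
      Tᶜ.card := by
    have := hilbert_projVanishingIdeal_image_eq_card p hΓm Tᶜ
    rwa [Finset.coe_compl] at this
  have hrefl : ∑ b ∈ Finset.range (m + 1), h'' (m - b) = ∑ b ∈ Finset.range (m + 1), h'' b := by
    have := Finset.sum_range_reflect h'' (m + 1)
    simpa only [Nat.add_sub_cancel] using this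
  have hsumeq : ∑ b ∈ Finset.range (m + 1), hJ b =
      ∑ b ∈ Finset.range (m + 1), (h' b + h'' (m - b)) := by
    rw [Finset.sum_add_distrib, hrefl, htelJ m, htel' m, htel'' m, hΓm, hΓ'm, hΓ''m, add_comm,
      Finset.card_compl_add_card]
  -- equality termwise ("the sum of their codimensions in `A` is the dimension of `R`")
  have hterm := (Finset.sum_eq_sum_iff_of_le hineq).mp hsumeq
  -- summing over `b ≤ kk`
  have hkk : ∑ b ∈ Finset.range (kk + 1), hJ b =
      ∑ b ∈ Finset.range (kk + 1), (h' b + h'' (m - b)) :=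
    Finset.sum_congr rfl fun b hb => hterm b (by rw [Finset.mem_range] at hb ⊢; omega)
  rw [Finset.sum_add_distrib, htelJ kk, htel' kk] at hkk
  have hsplit := sum_range_sub_add_sum_range (g := h'') (kk := kk) (a := a) (m := m) (by omega)
  rw [htel'' a, htel'' m, hΓ''m] at hsplit
  change (finrank k (homogeneousSubmodule (Fin (r + 1)) k kk) - finrank k (idealDegree IΓ kk)) +
      (finrank k (homogeneousSubmodule (Fin (r + 1)) k a) - finrank k (idealDegree I'' a)) =
    (finrank k (homogeneousSubmodule (Fin (r + 1)) k kk) - finrank k (idealDegree I' kk)) + Tᶜ.card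
  omega

/-- **EGH Theorem CB6, as printed**: "the dimension of the family of curves of degree `k` containing
`Γ'` (modulo those containing all of `Γ`) is equal to the failure of `Γ''` to impose independent
conditions of curves of complementary degree `s − k`": with `Γ' = {p_i}_{i ∈ T}`, `Γ'' = {p_i}_{i ∉ T}`,
`kk + a = s = Σ d_m − r − 1`,
**`dim_k I(Γ')_kk − dim_k I(Γ)_kk = #Γ'' − (dim_k S_a − dim_k I(Γ'')_a)`**.
[cite: EisenbudGreenHarris1996, Thm. CB6 (p. 304)] -/
theorem finrank_idealDegree_sub_eq_card_sub_hilbert [Infinite k] [DecidableEq ι] (hr : 1 ≤ r)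
    (f : Fin r → MvPolynomial (Fin (r + 1)) k) (d : Fin r → ℕ) (hf : ∀ m, (f m).IsHomogeneous (d m))
    (hd : ∀ m, 0 < d m) (hreg : IsWeaklyRegular (MvPolynomial (Fin (r + 1)) k) (List.ofFn f))
    (p : ι → Fin (r + 1) → k) (h0 : ∀ i, p i ≠ 0)
    (hp : Pairwise fun i j => p i ∉ (k ∙ p j : Submodule k (Fin (r + 1) → k)))
    (hZ : ∀ i m, eval (p i) (f m) = 0) (hcard : Fintype.card ι = ∏ m, d m) (T : Finset ι)
    {kk a : ℕ} (hka : kk + a + r + 1 = ∑ m, d m) :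
    finrank k (idealDegree (projVanishingIdeal (p '' (T : Set ι))) kk) -
        finrank k (idealDegree (projVanishingIdeal (Set.range p)) kk) =
      Tᶜ.card - (finrank k (homogeneousSubmodule (Fin (r + 1)) k a) -
        finrank k (idealDegree (projVanishingIdeal (p '' ((T : Set ι)ᶜ))) a)) := by
  have h := hilbert_add_hilbert_eq_of_completeIntersection hr f d hf hd hreg p h0 hp hZ hcard T hka
  have h1 := finrank_idealDegree_mono
    (projVanishingIdeal_anti (Set.image_subset_range p (T : Set ι))) kk
  have h2 := finrank_idealDegree_le (projVanishingIdeal (p '' (T : Set ι))) kk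
  have h3 := finrank_idealDegree_le (projVanishingIdeal (p '' ((T : Set ι)ᶜ))) a
  have h4 : finrank k (homogeneousSubmodule (Fin (r + 1)) k a) -
      finrank k (idealDegree (projVanishingIdeal (p '' ((T : Set ι)ᶜ))) a) ≤ Tᶜ.card := by
    have := hilbert_projVanishingIdeal_image_le_card p a Tᶜ
    rwa [Finset.coe_compl] at this
  omega

/-- **The Cayley–Bacharach theorem, Chasles–Cayley form (EGH Thm. CB4 for `r` hypersurfaces): a
hypersurface of degree `s = Σ d_m − r − 1` through all but one of the `∏ d_m` points contains them all**
— `I(Γ ∖ {p_i})_s = I(Γ)_s` ("any point `p ∈ Γ` imposes one independent condition on polynomials of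
degree `0`"). [cite: EisenbudGreenHarris1996, Thm. CB4 (p. 302), Thm. CB6 (p. 304)] -/
theorem idealDegree_projVanishingIdeal_image_compl_singleton_eq [Infinite k] [DecidableEq ι]
    (hr : 1 ≤ r) (f : Fin r → MvPolynomial (Fin (r + 1)) k) (d : Fin r → ℕ)
    (hf : ∀ m, (f m).IsHomogeneous (d m)) (hd : ∀ m, 0 < d m)
    (hreg : IsWeaklyRegular (MvPolynomial (Fin (r + 1)) k) (List.ofFn f))
    (p : ι → Fin (r + 1) → k) (h0 : ∀ i, p i ≠ 0)
    (hp : Pairwise fun i j => p i ∉ (k ∙ p j : Submodule k (Fin (r + 1) → k)))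
    (hZ : ∀ i m, eval (p i) (f m) = 0) (hcard : Fintype.card ι = ∏ m, d m) (i : ι)
    {s : ℕ} (hs : s + r + 1 = ∑ m, d m) :
    idealDegree (projVanishingIdeal (p '' ({i}ᶜ : Set ι))) s =
      idealDegree (projVanishingIdeal (Set.range p)) s := by
  have h := hilbert_add_hilbert_eq_of_completeIntersection hr f d hf hd hreg p h0 hp hZ hcard
    ({i}ᶜ : Finset ι) (kk := s) (a := 0) (by omega)
  rw [compl_compl, Finset.card_singleton, Finset.coe_compl, compl_compl, Finset.coe_singleton,
    Set.image_singleton, hilbert_projVanishingIdeal_singleton (h0 i) 0] at h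
  have hle : idealDegree (projVanishingIdeal (Set.range p)) s ≤
      idealDegree (projVanishingIdeal (p '' ({i}ᶜ : Set ι))) s :=
    idealDegree_mono (projVanishingIdeal_anti (Set.image_subset_range _ _)) s
  have h1 := Submodule.finrank_mono hle
  have h2 := finrank_idealDegree_le (projVanishingIdeal (p '' ({i}ᶜ : Set ι))) s
  exact (Submodule.eq_of_le_of_finrank_eq hle (by omega)).symm

/-- **EGH Theorem CB5 (Bacharach): two plane curves of degrees `d`, `e` meeting in `d · e` points.**
For forms `F, G ∈ k[x_0, x_1, x_2]` of positive degrees `d, e` with `[F, G]` weakly regular (no common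
factor), vanishing at `#ι = d e` distinct points `Γ = Γ' ⊔ Γ''`, and `kk + a = s = d + e − 3`:
`H_Γ(kk) + H_{Γ''}(a) = H_{Γ'}(kk) + #Γ''` — "the dimension of the vector space of forms of degree `k`
vanishing on `Γ'` (modulo those containing all of `Γ`) is equal to the failure of `Γ''` to impose
independent conditions on forms of degree `s − k`". [cite: EisenbudGreenHarris1996, Thm. CB5 (p. 303)] -/
theorem hilbert_add_hilbert_eq_of_planeCurves [Infinite k] [DecidableEq ι]
    (F G : MvPolynomial (Fin 3) k) {dF dG : ℕ} (hF : F.IsHomogeneous dF) (hG : G.IsHomogeneous dG)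
    (hdF : 0 < dF) (hdG : 0 < dG) (hreg : IsWeaklyRegular (MvPolynomial (Fin 3) k) [F, G])
    (p : ι → Fin 3 → k) (h0 : ∀ i, p i ≠ 0)
    (hp : Pairwise fun i j => p i ∉ (k ∙ p j : Submodule k (Fin 3 → k)))
    (hZF : ∀ i, eval (p i) F = 0) (hZG : ∀ i, eval (p i) G = 0) (hcard : Fintype.card ι = dF * dG)
    (T : Finset ι) {kk a : ℕ} (hka : kk + a + 3 = dF + dG) :
    (finrank k (homogeneousSubmodule (Fin 3) k kk) -
        finrank k (idealDegree (projVanishingIdeal (Set.range p)) kk)) +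
      (finrank k (homogeneousSubmodule (Fin 3) k a) -
        finrank k (idealDegree (projVanishingIdeal (p '' ((T : Set ι)ᶜ))) a)) =
      (finrank k (homogeneousSubmodule (Fin 3) k kk) -
        finrank k (idealDegree (projVanishingIdeal (p '' (T : Set ι))) kk)) + Tᶜ.card := by
  refine hilbert_add_hilbert_eq_of_completeIntersection (r := 2) (by norm_num) ![F, G] ![dF, dG]
    (fun m => ?_) (fun m => ?_) (by simpa using hreg) p h0 hp (fun i m => ?_)
    (by rw [hcard, Fin.prod_univ_two]; rfl) T (by rw [Fin.sum_univ_two]; exact hka)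
  · fin_cases m
    · exact hF
    · exact hG
  · fin_cases m
    · exact hdF
    · exact hdG
  · fin_cases m
    · exact hZF i
    · exact hZG i

/-- **Max Noether's `AF + BG` theorem in Cayley's transverse case**: two plane curves `F = 0`, `G = 0`
of positive degrees `d, e` without common component (`[F, G]` weakly regular) meeting in `d · e` distinct
points `Γ`: every form `H` vanishing at the points of `Γ` is `H = AF + BG`, i.e. `I(Γ) = (F, G)`.
[cite: EisenbudGreenHarris1996, §1.1 (p. 300)] -/
theorem projVanishingIdeal_eq_span_pair_of_planeCurves [Infinite k] (F G : MvPolynomial (Fin 3) k)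
    {dF dG : ℕ} (hF : F.IsHomogeneous dF) (hG : G.IsHomogeneous dG) (hdF : 0 < dF) (hdG : 0 < dG)
    (hreg : IsWeaklyRegular (MvPolynomial (Fin 3) k) [F, G]) (p : ι → Fin 3 → k) (h0 : ∀ i, p i ≠ 0)
    (hp : Pairwise fun i j => p i ∉ (k ∙ p j : Submodule k (Fin 3 → k)))
    (hZF : ∀ i, eval (p i) F = 0) (hZG : ∀ i, eval (p i) G = 0) (hcard : Fintype.card ι = dF * dG) :
    projVanishingIdeal (Set.range p) = Ideal.span {F, G} := by
  have h := projVanishingIdeal_eq_span_of_card_eq_prod (r := 2) (by norm_num) ![F, G] ![dF, dG]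
    (fun m => ?_) (fun m => ?_) (by simpa using hreg) p h0 hp (fun i m => ?_)
    (by rw [hcard, Fin.prod_univ_two]; rfl)
  · rw [h]
    congr 1
    ext x
    simp only [Set.mem_range, Set.mem_insert_iff, Set.mem_singleton_iff, Fin.exists_fin_two]
    constructor
    · rintro (h | h) <;> [left; right] <;> exact h.symm
    · rintro (rfl | rfl) <;> [left; right] <;> rfl
  · fin_cases m
    · exact hF
    · exact hG
  · fin_cases m
    · exact hdF
    · exact hdG
  · fin_cases m
    · exact hZF i
    · exact hZG i

end CompleteIntersection

end Literature.AlgebraicGeometry.ProjectiveSpace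

end
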